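import Literature.NumberTheory.EllipticCurves.KummerSelmerStructure
import Literature.NumberTheory.EllipticCurves.PeriodIndexObstructionBaseChange
import HarnessLib

/-!
# The Tate module under base change: `T_p(W)|_{Γ_E} ≅ T_p(W ×_K E)`

Topic `Literature/NumberTheory/EllipticCurves`. Definitions with bodies and proved API; **no named
fact**, no `sorry`, no instance, no notation.

For an elliptic curve `W` over a field `K` of characteristic `0`, a `K`-field `E` (typically a
completion `K_v`, or a finite extension of one) and a `K`-embedding `ι : K̄ → K̄_E` of algebraic
closures, the point map `E(K̄) → E(K̄_E) = (W ×_K E)(K̄_E)` (`pointsMapOfEmb`, file `Sha`, followed by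
the transport `(W ×_K E) ×_E K̄_E = W ×_K K̄_E`, `baseChange_baseChange_algebraicClosure`, file
`PeriodIndexObstructionBaseChange`) is injective and bijective on `n`-torsion for every `n ≠ 0`
(both torsion groups have `n²` elements, Silverman *AEC* III.6.4(b); the tree's `natCard_geomTorsion`),
hence induces an isomorphism of Tate modules

  `θ_∞ = T_p(ι_*) : T_p W = lim← W[pⁿ](K̄) ⥲ lim← (W ×_K E)[pⁿ](K̄_E) = T_p(W ×_K E)`

(`tateModuleEquivOfEmb`), `ℤ_p`-linear, a homeomorphism for the profinite topologies, and
EQUIVARIANT along the restriction `Γ_E → Γ_K` attached to `ι` (`resGalOfEmb ι`; for the tree's chosen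
embedding `closureEmb E = absClosureEmbedding K E` this is `absGaloisRestrict K E`):
`θ_∞ (σ|_{K̄} • a) = σ • θ_∞ a` (`tateModuleEquivOfEmb_smul`, `tateModuleEquiv_smul`). In the language
of the tree's continuous representations: `θ_∞` intertwines the RESTRICTED global representation
`(W.tateGaloisRep p _).restrict (absGaloisRestrict K E)` (the local representation
`tateLocalRep W p v` of the BSD files at `E = K_v`) with the Tate representation of the base-changed
curve `(W.baseChange E).tateGaloisRep p _` (`tateModuleEquiv_tateGaloisRep_restrict`), and likewise
for the rational Tate modules `V_p = ℚ_p ⊗ T_p` (`rationalTateModuleEquivOfEmb`,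
`rationalTateModuleEquiv_rationalTateGaloisRep_restrict`). This is the routine identification
"`T_ℓ(E)` is a `Gal(K̄_v/K_v)`-module via `Gal(K̄_v/K_v) ⊂ Gal(K̄/K)`, and as such it is the Tate
module of `E/K_v`" (Silverman, *AEC*, VII.§4 / proof of VII.7.1; Serre, *Abelian ℓ-adic
representations*, I.1.1–1.2), which the W2 consumers of the BSD cell need in order to transport
objects defined for a curve OVER a `p`-adic field `F` (the Néron de Rham line
`PAdicHodge.NeronDeRhamDatum hp (W.baseChange F)`, `nonempty_neronDeRhamDatum`) to the restricted
representation `V_p(W)|_{Γ_F}` on which their local cohomology `H¹(F, T_pW)` is built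
(`Theorems/KimAtThreeDeepLowerExpStarOmega`: "`Nonempty (LocalNeronLineAt W p v)` … follows from
`nonempty_neronDeRhamDatum` for `W ×_ℚ ℚ_v` once the restriction isomorphism
`V_p(W)|_{Γ_{ℚ_v}} ≅ V_p(W ×_ℚ ℚ_v)` of Tate modules is in the tree").

## Contents

* Generic (`Literature.NumberTheory.EllipticCurves.TateModule`, any abelian groups `A`, `B`):
  `map_injective`; `map_bijective_of_torsion` — `T_p f` is bijective as soon as `f` is injective and
  every `pⁿ`-torsion element of `B` is in the image of `f`; `continuous_map`; `continuous_of_proj`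
  (a map into `T_p A` is continuous iff its components are); `mapEquivOfTorsion` (the resulting
  `ℤ_p`-linear isomorphism) with `proj_mapEquivOfTorsion`, `map_proj_mapEquivOfTorsion_symm`, and the
  two continuity statements (`continuous_mapEquivOfTorsion`, `continuous_mapEquivOfTorsion_symm`, for
  discrete `A`, `B`).
* Elliptic (`Literature.NumberTheory.EllipticCurves`, `W : WeierstrassCurve K`, `E` a `K`-field):
  `geomPointsMapOfEmb W ι : geomPoints W →+ geomPoints (W.baseChange E)` (injective, equivariant along
  `resGalOfEmb ι`, onto the `n`-torsion for `n ≠ 0`); `tateModuleEquivOfEmb W ι p`,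
  `rationalTateModuleEquivOfEmb W ι p` and their specialisations `tateModuleEquiv W E p`,
  `rationalTateModuleEquiv W E p` to the chosen embedding, with the component formula, equivariance,
  continuity, and the intertwining statements for `galoisRepTate` / `rationalGaloisRepTate` and for the
  bundled `tateGaloisRep` / `rationalTateGaloisRep` restricted along `absGaloisRestrict K E`.

## References

* J. H. Silverman, *The Arithmetic of Elliptic Curves*, 2nd ed., GTM 106 (2009), III.§7 (Tate
  module, functoriality), Cor. III.6.4(b) (`#E[n] = n²`), VII.§4 and VIII.§1 (the local Galois group
  acting on `T_ℓ(E)` through `Gal(K̄_v/K_v) ⊂ Gal(K̄/K)`). [SilvermanAEC2009]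
* J.-P. Serre, *Abelian ℓ-adic representations and elliptic curves* (1968), Ch. I §1.1–1.2.
  [Serre1968]
-/

noncomputable section

open scoped Classical
open scoped TensorProduct

universe u v

namespace Literature.NumberTheory.EllipticCurves

/-! ## Generic part: `T_p` of an injection which is onto the `p`-power torsion -/

namespace TateModule

section Generic

variable {A : Type u} [AddCommGroup A] {B : Type v} [AddCommGroup B] {p : ℕ} [Fact p.Prime]

/-- `T_p f` is injective when `f` is (componentwise). [cite: SilvermanAEC2009, III.§7 (the Tate module as an inverse limit, functoriality)] -/
theorem map_injective {f : A →+ B} (hf : Function.Injective f) :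
    Function.Injective (map p f) := by
  intro a b h
  refine TateModule.ext fun n => hf ?_
  rw [← proj_map f a n, ← proj_map f b n, h]

/-- The compatible sequence of preimages: if `f` is injective and every `pⁿ`-torsion element of
`B` is a value of `f`, the componentwise preimage of an element of `T_p B` is an element of
`T_p A`. [folklore] -/
private theorem exists_preimage_seq {f : A →+ B} (hf : Function.Injective f)
    (hsurj : ∀ (n : ℕ) (b : B), p ^ n • b = 0 → ∃ a : A, f a = b) (b : TateModule B p) :
    ∃ a : TateModule A p, map p f a = b := by
  choose g hg using fun n => hsurj n (proj p n b) (pow_smul_proj n b)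
  refine ⟨mk g (fun n => hf ?_) (fun n => hf ?_), TateModule.ext fun n => ?_⟩
  · rw [map_nsmul, hg, pow_smul_proj, map_zero]
  · rw [map_nsmul, hg, hg, smul_proj_succ]
  · rw [proj_map, proj_mk, hg]

/-- **`T_p f` is bijective** as soon as `f : A →+ B` is injective and every `pⁿ`-torsion element
of `B` lies in the image of `f` (then `f` restricts to bijections `A[pⁿ] ⥲ B[pⁿ]`, and `T_p` is
their inverse limit). [cite: SilvermanAEC2009, III.§7 (the Tate module as an inverse limit, functoriality)] -/
theorem map_bijective_of_torsion {f : A →+ B} (hf : Function.Injective f)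
    (hsurj : ∀ (n : ℕ) (b : B), p ^ n • b = 0 → ∃ a : A, f a = b) :
    Function.Bijective (map p f) :=
  ⟨map_injective hf, fun b => exists_preimage_seq hf hsurj b⟩

omit [Fact p.Prime] in
/-- A map into `T_p A` is continuous iff all its components are (the topology of `T_p A` is
induced from the product `ℕ → A`). [cite: Serre1968, Ch. I §1.1 (the profinite topology of T_ℓ)] -/
theorem continuous_of_proj [TopologicalSpace A] {X : Type*} [TopologicalSpace X]
    {g : X → TateModule A p} (hg : ∀ n, Continuous fun x => proj p n (g x)) : Continuous g :=
  continuous_induced_rng.mpr (continuous_pi hg)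

/-- `T_p f` is continuous for `f` continuous (in particular always, for discrete `A`, `B`).
[cite: Serre1968, Ch. I §1.1 (the profinite topology of T_ℓ)] -/
theorem continuous_map [TopologicalSpace A] [TopologicalSpace B] {f : A →+ B}
    (hf : Continuous f) : Continuous (map p f) :=
  continuous_of_proj fun n => by
    simp only [proj_map]
    exact hf.comp (continuous_proj n)

/-- **The isomorphism `T_p A ≃ T_p B` induced by an injection `f : A →+ B` onto the `p`-power
torsion** (`LinearEquiv.ofBijective` of `T_p f`). [cite: SilvermanAEC2009, III.§7 (the Tate module as an inverse limit, functoriality)] -/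
def mapEquivOfTorsion (f : A →+ B) (hf : Function.Injective f)
    (hsurj : ∀ (n : ℕ) (b : B), p ^ n • b = 0 → ∃ a : A, f a = b) :
    TateModule A p ≃ₗ[ℤ_[p]] TateModule B p :=
  LinearEquiv.ofBijective (map p f) (map_bijective_of_torsion hf hsurj)

/-- `mapEquivOfTorsion f` is `T_p f`. [cite: SilvermanAEC2009, III.§7] -/
@[simp]
theorem mapEquivOfTorsion_apply (f : A →+ B) (hf : Function.Injective f)
    (hsurj : ∀ (n : ℕ) (b : B), p ^ n • b = 0 → ∃ a : A, f a = b) (a : TateModule A p) :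
    mapEquivOfTorsion f hf hsurj a = map p f a := rfl

/-- Components of `mapEquivOfTorsion f`: `(θ_∞ a)_n = f a_n`. [cite: SilvermanAEC2009, III.§7] -/
theorem proj_mapEquivOfTorsion (f : A →+ B) (hf : Function.Injective f)
    (hsurj : ∀ (n : ℕ) (b : B), p ^ n • b = 0 → ∃ a : A, f a = b) (a : TateModule A p) (n : ℕ) :
    proj p n (mapEquivOfTorsion f hf hsurj a) = f (proj p n a) := rfl

/-- Components of the inverse: `f ((θ_∞⁻¹ b)_n) = b_n`. [cite: SilvermanAEC2009, III.§7] -/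
theorem map_proj_mapEquivOfTorsion_symm (f : A →+ B) (hf : Function.Injective f)
    (hsurj : ∀ (n : ℕ) (b : B), p ^ n • b = 0 → ∃ a : A, f a = b) (b : TateModule B p) (n : ℕ) :
    f (proj p n ((mapEquivOfTorsion f hf hsurj).symm b)) = proj p n b := by
  conv_rhs => rw [← (mapEquivOfTorsion f hf hsurj).apply_symm_apply b]
  rfl

/-- `mapEquivOfTorsion f` is continuous (discrete `A`, `B`). [cite: Serre1968, Ch. I §1.1 (the profinite topology of T_ℓ)] -/
theorem continuous_mapEquivOfTorsion [TopologicalSpace A] [DiscreteTopology A] [TopologicalSpace B]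
    (f : A →+ B) (hf : Function.Injective f)
    (hsurj : ∀ (n : ℕ) (b : B), p ^ n • b = 0 → ∃ a : A, f a = b) :
    Continuous (mapEquivOfTorsion (p := p) f hf hsurj) :=
  continuous_map continuous_of_discreteTopology

/-- The inverse of `mapEquivOfTorsion f` is continuous (discrete `A`, `B`): its `n`-th component
factors through the continuous projection `T_p B → B` to the discrete group `B`.
[cite: Serre1968, Ch. I §1.1 (the profinite topology of T_ℓ)] -/
theorem continuous_mapEquivOfTorsion_symm [TopologicalSpace A] [TopologicalSpace B]
    [DiscreteTopology B] (f : A →+ B) (hf : Function.Injective f)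
    (hsurj : ∀ (n : ℕ) (b : B), p ^ n • b = 0 → ∃ a : A, f a = b) :
    Continuous (mapEquivOfTorsion (p := p) f hf hsurj).symm := by
  refine continuous_of_proj fun n => ?_
  -- the `n`-th component is `g ∘ proj n` for the partial inverse `g` of `f`
  let g : B → A := fun y => if h : ∃ a, f a = y then h.choose else 0
  have hfac : (fun b => proj p n ((mapEquivOfTorsion f hf hsurj).symm b)) = g ∘ proj p n := by
    funext b
    have hex : ∃ a, f a = proj p n b :=
      ⟨proj p n ((mapEquivOfTorsion f hf hsurj).symm b), map_proj_mapEquivOfTorsion_symm f hf hsurj b n⟩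
    have hg : f (g (proj p n b)) = proj p n b := by
      simp only [g, dif_pos hex]
      exact hex.choose_spec
    exact hf ((map_proj_mapEquivOfTorsion_symm f hf hsurj b n).trans hg.symm)
  rw [hfac]
  exact continuous_of_discreteTopology.comp (continuous_proj n)

end Generic

end TateModule

/-! ## The elliptic case -/

section Elliptic

open WeierstrassCurve

variable {K : Type u} [Field K] (W : WeierstrassCurve K) (E : Type u) [Field E] [Algebra K E]

/-! ### The point map `E(K̄) → (W ×_K E)(K̄_E)` along an embedding `ι : K̄ → K̄_E` -/

/-- The transport `E(K̄_E) = (W ×_K K̄_E)(K̄_E) ≃+ ((W ×_K E) ×_E K̄_E)(K̄_E)` (identity on coordinates)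
along `baseChange_baseChange_algebraicClosure`: the local points of the tree's `Sha.lean` ARE the
geometric points of the base-changed curve. [cite: SilvermanAEC2009, III.§1–2 and VIII.§1] -/
def localPointsEquivBaseChange : localPoints W E ≃+ geomPoints (W.baseChange E) :=
  Affine.Point.congrEquiv (baseChange_baseChange_algebraicClosure W (E := E)).symm

/-- `localPointsEquivBaseChange` carries the `Γ_E`-action through `Aut_K(K̄_E)` (file `Sha`) to the
coordinatewise action on the geometric points of `W ×_K E` (`congrEquiv_symm_smul`).
[cite: SilvermanAEC2009, VIII.§1 (Galois action on points)] -/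
theorem localPointsEquivBaseChange_smul (σ : Field.absoluteGaloisGroup E) (R : localPoints W E) :
    localPointsEquivBaseChange W E (σ • R) = σ • localPointsEquivBaseChange W E R :=
  congrEquiv_symm_smul W σ R

variable {E}
variable (ι : AlgebraicClosure K →ₐ[K] AlgebraicClosure E)

/-- **The point map `θ = ι_* : E(K̄) → (W ×_K E)(K̄_E)`** along a `K`-embedding `ι : K̄ → K̄_E`
(`pointsMapOfEmb` followed by `localPointsEquivBaseChange`). [cite: SilvermanAEC2009, III.§7 and VII.§4 (T_ℓ(E) as a module for the decomposition group)] -/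
def geomPointsMapOfEmb : geomPoints W →+ geomPoints (W.baseChange E) :=
  (localPointsEquivBaseChange W E).toAddMonoidHom.comp (pointsMapOfEmb W ι)

/-- Unfolding `geomPointsMapOfEmb`. [cite: SilvermanAEC2009, III.§7 and VII.§4] -/
theorem geomPointsMapOfEmb_apply (P : geomPoints W) :
    geomPointsMapOfEmb W ι P = Affine.Point.congrEquiv
      (baseChange_baseChange_algebraicClosure W (E := E)).symm (pointsMapOfEmb W ι P) := rfl

/-- `θ = ι_*` is injective. [cite: SilvermanAEC2009, III.§7 and VII.§4] -/
theorem geomPointsMapOfEmb_injective : Function.Injective (geomPointsMapOfEmb W ι) :=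
  theta_injective W ι (geomPointsMapOfEmb W ι) (geomPointsMapOfEmb_apply W ι)

/-- **`θ = ι_*` is equivariant along `Γ_E → Γ_K`**: `θ (σ|_{K̄} • P) = σ • θ P`
(`theta_smul`). [cite: SilvermanAEC2009, VIII.§1 (Galois action on points)] -/
theorem geomPointsMapOfEmb_smul (σ : Field.absoluteGaloisGroup E) (P : geomPoints W) :
    geomPointsMapOfEmb W ι (resGalOfEmb ι σ • P) = σ • geomPointsMapOfEmb W ι P :=
  theta_smul W ι (geomPointsMapOfEmb W ι) (geomPointsMapOfEmb_apply W ι) σ P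

/-- `θ` maps `n`-torsion to `n`-torsion. [cite: SilvermanAEC2009, III.§7 and VII.§4] -/
theorem geomPointsMapOfEmb_mem_geomTorsion {n : ℤ} {P : geomPoints W} (hP : P ∈ geomTorsion W n) :
    geomPointsMapOfEmb W ι P ∈ geomTorsion (W.baseChange E) n := by
  rw [mem_geomTorsion_iff] at hP ⊢
  rw [← map_zsmul, hP, map_zero]

/-- `θ` restricted to the `n`-torsion: `W[n](K̄) →+ (W ×_K E)[n](K̄_E)`. [cite: SilvermanAEC2009, III.§7 and VII.§4] -/
def geomTorsionMapOfEmb (n : ℤ) : geomTorsion W n →+ geomTorsion (W.baseChange E) n :=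
  ((geomPointsMapOfEmb W ι).comp (geomTorsion W n).subtype).codRestrict _ fun P =>
    geomPointsMapOfEmb_mem_geomTorsion W ι P.2

/-- Underlying point of `geomTorsionMapOfEmb`. [cite: SilvermanAEC2009, III.§7 and VII.§4] -/
@[simp]
theorem coe_geomTorsionMapOfEmb (n : ℤ) (P : geomTorsion W n) :
    (geomTorsionMapOfEmb W ι n P : geomPoints (W.baseChange E)) = geomPointsMapOfEmb W ι P := rfl

/-- **`θ` is bijective on `n`-torsion for `n ≠ 0`** (elliptic curve, characteristic `0`): it is
injective between two groups of order `n²` (Silverman, *AEC*, Cor. III.6.4(b); the tree's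
`natCard_geomTorsion` over `K̄` and over `K̄_E`). All the torsion of `W ×_K E` is algebraic over `K`.
[cite: SilvermanAEC2009, Cor. III.6.4(b)] -/
theorem geomTorsionMapOfEmb_bijective [CharZero K] [W.IsElliptic] {n : ℤ} (hn : n ≠ 0) :
    Function.Bijective (geomTorsionMapOfEmb W ι n) := by
  haveI : CharZero E := charZero_of_injective_algebraMap (algebraMap K E).injective
  haveI : Finite (geomTorsion (W.baseChange E) n) :=
    Nat.finite_of_card_ne_zero (by
      rw [natCard_geomTorsion (W.baseChange E) n hn]
      exact pow_ne_zero 2 (Int.natAbs_ne_zero.mpr hn))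
  refine (Nat.bijective_iff_injective_and_card _).mpr ⟨fun P Q h => ?_, ?_⟩
  · exact Subtype.ext (geomPointsMapOfEmb_injective W ι (congrArg Subtype.val h))
  · rw [natCard_geomTorsion W n hn, natCard_geomTorsion (W.baseChange E) n hn]

/-- Every `n`-torsion point of `W ×_K E` over `K̄_E` (`n ≠ 0`) is `θ` of an `n`-torsion point of
`W` over `K̄`. [cite: SilvermanAEC2009, Cor. III.6.4(b)] -/
theorem exists_geomPointsMapOfEmb_eq_of_mem_geomTorsion [CharZero K] [W.IsElliptic] {n : ℤ}
    (hn : n ≠ 0) {Q : geomPoints (W.baseChange E)} (hQ : Q ∈ geomTorsion (W.baseChange E) n) :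
    ∃ P ∈ geomTorsion W n, geomPointsMapOfEmb W ι P = Q := by
  obtain ⟨P, hP⟩ := (geomTorsionMapOfEmb_bijective W ι hn).2 ⟨Q, hQ⟩
  exact ⟨P, P.2, congrArg Subtype.val hP⟩

/-! ### The Tate module along `ι` -/

variable (p : ℕ) [Fact p.Prime] [CharZero K] [W.IsElliptic]

/-- The torsion hypothesis of `TateModule.mapEquivOfTorsion` for `θ = ι_*`. [folklore] -/
private theorem torsion_surj (n : ℕ) (Q : geomPoints (W.baseChange E)) (hQ : p ^ n • Q = 0) :
    ∃ P : geomPoints W, geomPointsMapOfEmb W ι P = Q := by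
  have hn : ((p ^ n : ℕ) : ℤ) ≠ 0 := by
    exact_mod_cast pow_ne_zero n (Fact.out : p.Prime).ne_zero
  have hQ' : Q ∈ geomTorsion (W.baseChange E) ((p ^ n : ℕ) : ℤ) := by
    rw [mem_geomTorsion_iff, natCast_zsmul, hQ]
  obtain ⟨P, -, hP⟩ := exists_geomPointsMapOfEmb_eq_of_mem_geomTorsion W ι hn hQ'
  exact ⟨P, hP⟩

/-- **The restriction isomorphism of Tate modules `θ_∞ = T_p(ι_*) : T_p W ⥲ T_p(W ×_K E)`** along a
`K`-embedding `ι : K̄ → K̄_E` (`ℤ_p`-linear; `TateModule.mapEquivOfTorsion` of `θ = ι_*`, which is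
injective and onto the `p`-power torsion). [cite: SilvermanAEC2009, III.§7 and VII.§4] [cite: Serre1968, Ch. I §1.1–1.2] -/
def tateModuleEquivOfEmb : W.tateModule p ≃ₗ[ℤ_[p]] (W.baseChange E).tateModule p :=
  TateModule.mapEquivOfTorsion (geomPointsMapOfEmb W ι) (geomPointsMapOfEmb_injective W ι)
    (torsion_surj W ι p)

/-- `θ_∞ = T_p(ι_*)` as a map. [cite: SilvermanAEC2009, III.§7 and VII.§4] -/
theorem tateModuleEquivOfEmb_apply (a : W.tateModule p) :
    tateModuleEquivOfEmb W ι p a = TateModule.map p (geomPointsMapOfEmb W ι) a := rfl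

/-- Components: `(θ_∞ a)_n = ι_* a_n`. [cite: SilvermanAEC2009, III.§7 and VII.§4] -/
@[simp]
theorem proj_tateModuleEquivOfEmb (a : W.tateModule p) (n : ℕ) :
    TateModule.proj p n (tateModuleEquivOfEmb W ι p a) =
      geomPointsMapOfEmb W ι (TateModule.proj p n a) := rfl

/-- Components of the inverse: `ι_* ((θ_∞⁻¹ b)_n) = b_n`. [cite: SilvermanAEC2009, III.§7 and VII.§4] -/
theorem geomPointsMapOfEmb_proj_tateModuleEquivOfEmb_symm (b : (W.baseChange E).tateModule p)
    (n : ℕ) :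
    geomPointsMapOfEmb W ι (TateModule.proj p n ((tateModuleEquivOfEmb W ι p).symm b)) =
      TateModule.proj p n b :=
  TateModule.map_proj_mapEquivOfTorsion_symm _ _ _ b n

/-- **`θ_∞` is equivariant along `Γ_E → Γ_K`**: `θ_∞ (σ|_{K̄} • a) = σ • θ_∞ a`.
[cite: SilvermanAEC2009, III.§7 and VII.§4 (T_ℓ(E) as a module for the decomposition group)] -/
theorem tateModuleEquivOfEmb_smul (σ : Field.absoluteGaloisGroup E) (a : W.tateModule p) :
    tateModuleEquivOfEmb W ι p (resGalOfEmb ι σ • a) = σ • tateModuleEquivOfEmb W ι p a :=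
  TateModule.ext fun n => by
    rw [proj_tateModuleEquivOfEmb, TateModule.proj_smul_of_distribMulAction,
      TateModule.proj_smul_of_distribMulAction, proj_tateModuleEquivOfEmb, geomPointsMapOfEmb_smul]

/-- Equivariance of `θ_∞⁻¹`: `θ_∞⁻¹ (σ • b) = σ|_{K̄} • θ_∞⁻¹ b`. [cite: SilvermanAEC2009, III.§7 and VII.§4] -/
theorem tateModuleEquivOfEmb_symm_smul (σ : Field.absoluteGaloisGroup E)
    (b : (W.baseChange E).tateModule p) :
    (tateModuleEquivOfEmb W ι p).symm (σ • b) = resGalOfEmb ι σ • (tateModuleEquivOfEmb W ι p).symm b := by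
  apply (tateModuleEquivOfEmb W ι p).injective
  rw [LinearEquiv.apply_symm_apply, tateModuleEquivOfEmb_smul, LinearEquiv.apply_symm_apply]

/-- `θ_∞` is continuous (profinite topologies). [cite: Serre1968, Ch. I §1.1] -/
theorem continuous_tateModuleEquivOfEmb : Continuous (tateModuleEquivOfEmb W ι p) :=
  TateModule.continuous_mapEquivOfTorsion _ _ _

/-- `θ_∞⁻¹` is continuous. [cite: Serre1968, Ch. I §1.1] -/
theorem continuous_tateModuleEquivOfEmb_symm : Continuous (tateModuleEquivOfEmb W ι p).symm :=
  TateModule.continuous_mapEquivOfTorsion_symm _ _ _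

/-- `θ_∞` intertwines the Galois representations: `θ_∞ ∘ ρ_{W,p}(σ|_{K̄}) = ρ_{W×E,p}(σ) ∘ θ_∞`.
[cite: SilvermanAEC2009, III.§7 and VII.§4] -/
theorem tateModuleEquivOfEmb_galoisRepTate (σ : Field.absoluteGaloisGroup E) (a : W.tateModule p) :
    tateModuleEquivOfEmb W ι p (W.galoisRepTate p (resGalOfEmb ι σ) a) =
      (W.baseChange E).galoisRepTate p σ (tateModuleEquivOfEmb W ι p a) := by
  rw [galoisRepTate_apply_apply, galoisRepTate_apply_apply, tateModuleEquivOfEmb_smul]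

/-! ### The rational Tate module along `ι` -/

/-- **`V_p(ι_*) : V_p W ⥲ V_p(W ×_K E)`**, the `ℚ_p`-base change of `θ_∞`. [cite: Serre1968, Ch. I §1.2 (V_ℓ = T_ℓ ⊗ ℚ_ℓ)] -/
def rationalTateModuleEquivOfEmb :
    W.rationalTateModule p ≃ₗ[ℚ_[p]] (W.baseChange E).rationalTateModule p :=
  (LinearEquiv.baseChange ℤ_[p] ℚ_[p] (W.tateModule p) ((W.baseChange E).tateModule p)
      (tateModuleEquivOfEmb W ι p) :
    ℚ_[p] ⊗[ℤ_[p]] W.tateModule p ≃ₗ[ℚ_[p]] ℚ_[p] ⊗[ℤ_[p]] (W.baseChange E).tateModule p)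

/-- `V_p(ι_*)` on pure tensors: `c ⊗ a ↦ c ⊗ θ_∞ a`. [cite: SilvermanAEC2009, III.§7 and VII.§4] -/
@[simp]
theorem rationalTateModuleEquivOfEmb_tmul (c : ℚ_[p]) (a : W.tateModule p) :
    rationalTateModuleEquivOfEmb W ι p ((c ⊗ₜ[ℤ_[p]] a : ℚ_[p] ⊗[ℤ_[p]] W.tateModule p) :
        W.rationalTateModule p) =
      ((c ⊗ₜ[ℤ_[p]] tateModuleEquivOfEmb W ι p a : ℚ_[p] ⊗[ℤ_[p]] (W.baseChange E).tateModule p) :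
        (W.baseChange E).rationalTateModule p) :=
  rfl

/-- `V_p(ι_*)` extends `θ_∞` along `T_p → V_p`. [cite: SilvermanAEC2009, III.§7 and VII.§4] -/
theorem rationalTateModuleEquivOfEmb_toRational (a : W.tateModule p) :
    rationalTateModuleEquivOfEmb W ι p (TateModule.toRational p a) =
      TateModule.toRational p (tateModuleEquivOfEmb W ι p a) :=
  rationalTateModuleEquivOfEmb_tmul W ι p 1 a

/-- **`V_p(ι_*)` intertwines the rational Galois representations**:
`V_p(ι_*) ∘ ρ_{W,p}(σ|_{K̄}) = ρ_{W×E,p}(σ) ∘ V_p(ι_*)`. [cite: Serre1968, Ch. I §1.2] -/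
theorem rationalTateModuleEquivOfEmb_rationalGaloisRepTate (σ : Field.absoluteGaloisGroup E)
    (x : W.rationalTateModule p) :
    rationalTateModuleEquivOfEmb W ι p (W.rationalGaloisRepTate p (resGalOfEmb ι σ) x) =
      (W.baseChange E).rationalGaloisRepTate p σ (rationalTateModuleEquivOfEmb W ι p x) := by
  have key : (rationalTateModuleEquivOfEmb W ι p).toLinearMap ∘ₗ
        W.rationalGaloisRepTate p (resGalOfEmb ι σ) =
      (W.baseChange E).rationalGaloisRepTate p σ ∘ₗ (rationalTateModuleEquivOfEmb W ι p).toLinearMap := by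
    refine TensorProduct.AlgebraTensorModule.ext fun c a => ?_
    change ((c ⊗ₜ[ℤ_[p]] tateModuleEquivOfEmb W ι p (resGalOfEmb ι σ • a) :
          ℚ_[p] ⊗[ℤ_[p]] (W.baseChange E).tateModule p) : (W.baseChange E).rationalTateModule p) =
      ((c ⊗ₜ[ℤ_[p]] (σ • tateModuleEquivOfEmb W ι p a) :
          ℚ_[p] ⊗[ℤ_[p]] (W.baseChange E).tateModule p) : (W.baseChange E).rationalTateModule p)
    rw [tateModuleEquivOfEmb_smul]
  exact LinearMap.congr_fun key x

/-- `V_p(ι_*)` is continuous (module topologies over `ℚ_p`). [cite: SilvermanAEC2009, III.§7 and VII.§4] -/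
theorem continuous_rationalTateModuleEquivOfEmb : Continuous (rationalTateModuleEquivOfEmb W ι p) :=
  IsModuleTopology.continuous_of_linearMap (rationalTateModuleEquivOfEmb W ι p).toLinearMap

/-- `V_p(ι_*)⁻¹` is continuous. [cite: SilvermanAEC2009, III.§7 and VII.§4] -/
theorem continuous_rationalTateModuleEquivOfEmb_symm :
    Continuous (rationalTateModuleEquivOfEmb W ι p).symm :=
  IsModuleTopology.continuous_of_linearMap (rationalTateModuleEquivOfEmb W ι p).symm.toLinearMap

/-! ### The chosen embedding: `θ_∞` along `absGaloisRestrict K E` -/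

variable (E)

/-- **The restriction isomorphism `T_p W ⥲ T_p(W ×_K E)`** for the tree's CHOSEN embedding
`closureEmb E : K̄ → K̄_E` (= `absClosureEmbedding K E`, both `IsAlgClosed.lift`), equivariant along
`absGaloisRestrict K E` — the restriction used by `GaloisRep.restrictField` / `tateLocalRep`.
[cite: SilvermanAEC2009, III.§7 and VII.§4] [cite: Serre1968, Ch. I §1.1–1.2] -/
def tateModuleEquiv : W.tateModule p ≃ₗ[ℤ_[p]] (W.baseChange E).tateModule p :=
  tateModuleEquivOfEmb W (closureEmb (K := K) E) p

/-- `tateModuleEquiv` is `tateModuleEquivOfEmb` at the chosen embedding. [cite: SilvermanAEC2009, III.§7 and VII.§4] -/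
theorem tateModuleEquiv_eq :
    tateModuleEquiv W E p = tateModuleEquivOfEmb W (closureEmb (K := K) E) p := rfl

/-- Components: `(θ_∞ a)_n` is the transport of `pointsMap W E a_n`. [cite: SilvermanAEC2009, III.§7 and VII.§4] -/
theorem proj_tateModuleEquiv (a : W.tateModule p) (n : ℕ) :
    TateModule.proj p n (tateModuleEquiv W E p a) =
      localPointsEquivBaseChange W E (pointsMap W E (TateModule.proj p n a)) := rfl

/-- **Equivariance along `absGaloisRestrict K E`**: `θ_∞ (σ|_{K̄} • a) = σ • θ_∞ a`.
[cite: SilvermanAEC2009, III.§7 and VII.§4 (T_ℓ(E) as a module for the decomposition group)] -/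
theorem tateModuleEquiv_smul (σ : Field.absoluteGaloisGroup E) (a : W.tateModule p) :
    tateModuleEquiv W E p (GaloisRepresentations.absGaloisRestrict K E σ • a) =
      σ • tateModuleEquiv W E p a := by
  rw [← resGal_eq_absGaloisRestrict]
  exact tateModuleEquivOfEmb_smul W _ p σ a

/-- Equivariance of `θ_∞⁻¹` along `absGaloisRestrict K E`. [cite: SilvermanAEC2009, III.§7 and VII.§4] -/
theorem tateModuleEquiv_symm_smul (σ : Field.absoluteGaloisGroup E)
    (b : (W.baseChange E).tateModule p) :
    (tateModuleEquiv W E p).symm (σ • b) =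
      GaloisRepresentations.absGaloisRestrict K E σ • (tateModuleEquiv W E p).symm b := by
  rw [← resGal_eq_absGaloisRestrict]
  exact tateModuleEquivOfEmb_symm_smul W _ p σ b

/-- `θ_∞` is a homeomorphism onto: continuity. [cite: SilvermanAEC2009, III.§7 and VII.§4] -/
theorem continuous_tateModuleEquiv : Continuous (tateModuleEquiv W E p) :=
  continuous_tateModuleEquivOfEmb W _ p

/-- Continuity of `θ_∞⁻¹`. [cite: SilvermanAEC2009, III.§7 and VII.§4] -/
theorem continuous_tateModuleEquiv_symm : Continuous (tateModuleEquiv W E p).symm :=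
  continuous_tateModuleEquivOfEmb_symm W _ p

/-- **`θ_∞` intertwines the RESTRICTED global Tate representation with the Tate representation of
the base change**: for the bundled continuous representations of the tree (any continuity
witnesses `h`, `h'`), `θ_∞ (((W.tateGaloisRep p h).restrict (absGaloisRestrict K E)) σ a) =
((W.baseChange E).tateGaloisRep p h') σ (θ_∞ a)` — at `E = K_v` the left representation is the BSD
files' `tateLocalRep W p v` (up to `toIntRep`). [cite: SilvermanAEC2009, III.§7 and VII.§4] -/
theorem tateModuleEquiv_tateGaloisRep_restrict
    (h : Continuous fun x : Field.absoluteGaloisGroup K × W.tateModule p => W.galoisRepTate p x.1 x.2)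
    (h' : Continuous fun x : Field.absoluteGaloisGroup E × (W.baseChange E).tateModule p =>
      (W.baseChange E).galoisRepTate p x.1 x.2)
    (σ : Field.absoluteGaloisGroup E) (a : W.tateModule p) :
    tateModuleEquiv W E p
        (((W.tateGaloisRep p h).restrict (GaloisRepresentations.absGaloisRestrict K E)) σ a) =
      ((W.baseChange E).tateGaloisRep p h') σ (tateModuleEquiv W E p a) := by
  rw [GaloisRepresentations.ContinuousRep.restrict_apply]
  change tateModuleEquiv W E p (W.galoisRepTate p (GaloisRepresentations.absGaloisRestrict K E σ) a) =
    (W.baseChange E).galoisRepTate p σ (tateModuleEquiv W E p a)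
  rw [galoisRepTate_apply_apply, galoisRepTate_apply_apply, tateModuleEquiv_smul]

/-- **The restriction isomorphism `V_p W ⥲ V_p(W ×_K E)`** for the chosen embedding.
[cite: Serre1968, Ch. I §1.2] -/
def rationalTateModuleEquiv : W.rationalTateModule p ≃ₗ[ℚ_[p]] (W.baseChange E).rationalTateModule p :=
  rationalTateModuleEquivOfEmb W (closureEmb (K := K) E) p

/-- `rationalTateModuleEquiv` is `rationalTateModuleEquivOfEmb` at the chosen embedding. [cite: SilvermanAEC2009, III.§7 and VII.§4] -/
theorem rationalTateModuleEquiv_eq :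
    rationalTateModuleEquiv W E p = rationalTateModuleEquivOfEmb W (closureEmb (K := K) E) p := rfl

/-- `V_p(ι_*)` extends `θ_∞` along `T_p → V_p` (chosen embedding). [cite: SilvermanAEC2009, III.§7 and VII.§4] -/
theorem rationalTateModuleEquiv_toRational (a : W.tateModule p) :
    rationalTateModuleEquiv W E p (TateModule.toRational p a) =
      TateModule.toRational p (tateModuleEquiv W E p a) :=
  rationalTateModuleEquivOfEmb_toRational W _ p a

/-- **Equivariance of `V_p W ⥲ V_p(W ×_K E)` along `absGaloisRestrict K E`** for the rational
Galois representations. [cite: Serre1968, Ch. I §1.2] -/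
theorem rationalTateModuleEquiv_rationalGaloisRepTate (σ : Field.absoluteGaloisGroup E)
    (x : W.rationalTateModule p) :
    rationalTateModuleEquiv W E p
        (W.rationalGaloisRepTate p (GaloisRepresentations.absGaloisRestrict K E σ) x) =
      (W.baseChange E).rationalGaloisRepTate p σ (rationalTateModuleEquiv W E p x) := by
  rw [← resGal_eq_absGaloisRestrict]
  exact rationalTateModuleEquivOfEmb_rationalGaloisRepTate W _ p σ x

/-- The same for the bundled continuous representations of the tree (any continuity witnesses):
`V_p(ι_*)` intertwines `(W.rationalTateGaloisRep p h).restrict (absGaloisRestrict K E)` — the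
`localRationalTateRep` of the BSD files at `E = ℚ_v` — with `(W.baseChange E).rationalTateGaloisRep p h'`
(the representation of `PAdicHodge.NeronDeRhamDatum`). This is the hypothesis `hφ` of the tree's
`PeriodRingData.FilZeroLine.map` / `dualExp_map`. [cite: Serre1968, Ch. I §1.2] -/
theorem rationalTateModuleEquiv_rationalTateGaloisRep_restrict
    (h : Continuous fun x : Field.absoluteGaloisGroup K × W.rationalTateModule p =>
      W.rationalGaloisRepTate p x.1 x.2)
    (h' : Continuous fun x : Field.absoluteGaloisGroup E × (W.baseChange E).rationalTateModule p =>
      (W.baseChange E).rationalGaloisRepTate p x.1 x.2)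
    (σ : Field.absoluteGaloisGroup E) (x : W.rationalTateModule p) :
    rationalTateModuleEquiv W E p
        (((W.rationalTateGaloisRep p h).restrict (GaloisRepresentations.absGaloisRestrict K E)) σ x) =
      ((W.baseChange E).rationalTateGaloisRep p h') σ (rationalTateModuleEquiv W E p x) := by
  rw [GaloisRepresentations.ContinuousRep.restrict_apply]
  exact rationalTateModuleEquiv_rationalGaloisRepTate W E p σ x

/-- The inverse direction, in the shape of the hypothesis `hφ : ∀ σ m, φ (ρ σ m) = ρ' σ (φ m)` of
`PeriodRingData.FilZeroLine.map` with `φ = V_p(ι_*)⁻¹`, `ρ` the representation of `W ×_K E` and `ρ'`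
the restricted representation of `W`. [cite: SilvermanAEC2009, III.§7 and VII.§4] -/
theorem rationalTateModuleEquiv_symm_rationalTateGaloisRep
    (h : Continuous fun x : Field.absoluteGaloisGroup K × W.rationalTateModule p =>
      W.rationalGaloisRepTate p x.1 x.2)
    (h' : Continuous fun x : Field.absoluteGaloisGroup E × (W.baseChange E).rationalTateModule p =>
      (W.baseChange E).rationalGaloisRepTate p x.1 x.2)
    (σ : Field.absoluteGaloisGroup E) (y : (W.baseChange E).rationalTateModule p) :
    (rationalTateModuleEquiv W E p).symm (((W.baseChange E).rationalTateGaloisRep p h') σ y) =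
      ((W.rationalTateGaloisRep p h).restrict (GaloisRepresentations.absGaloisRestrict K E)) σ
        ((rationalTateModuleEquiv W E p).symm y) := by
  apply (rationalTateModuleEquiv W E p).injective
  rw [LinearEquiv.apply_symm_apply, rationalTateModuleEquiv_rationalTateGaloisRep_restrict W E p h h',
    LinearEquiv.apply_symm_apply]

/-- Continuity of `V_p W ⥲ V_p(W ×_K E)`. [cite: SilvermanAEC2009, III.§7 and VII.§4] -/
theorem continuous_rationalTateModuleEquiv : Continuous (rationalTateModuleEquiv W E p) :=
  continuous_rationalTateModuleEquivOfEmb W _ p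

/-- Continuity of its inverse. [cite: SilvermanAEC2009, III.§7 and VII.§4] -/
theorem continuous_rationalTateModuleEquiv_symm : Continuous (rationalTateModuleEquiv W E p).symm :=
  continuous_rationalTateModuleEquivOfEmb_symm W _ p

end Elliptic

end Literature.NumberTheory.EllipticCurves

end
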